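import Summits.CriticalPhenomena.Ising3DConformalLimit.Theses.SynchronousCoupling
import Summits.CriticalPhenomena.Ising3DConformalLimit.Theorems.HyperoctahedralRPExistsScaleCovariantLimitCompactnessItemMapsDoubling
import Literature.Probability.LatticeModels.CriticalTwoPointLawDimension
import Literature.Probability.LatticeModels.PointwiseScalingLimitEtaExists
import Literature.Probability.LatticeModels.SharpnessProofs
import Summits.CriticalPhenomena.Ising3DConformalLimit.Theorems.SynchronousCouplingUniformRegularityStubFieldMonotone
import Summits.CriticalPhenomena.Ising3DConformalLimit.Theorems.SynchronousCouplingUniformRegularityStubGhsSandwich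
import Summits.CriticalPhenomena.Ising3DConformalLimit.Theorems.SynchronousCouplingUniformRegularityStubMagnetizationRegular
import Summits.CriticalPhenomena.Ising3DConformalLimit.Theorems.SynchronousCouplingUniformRegularityStubTruncatedSumRule
import HarnessLib

/-!
# Line `Sketch` (magnetic ruler) for crux `UniformRegularity` (stmt-CriticalPhenomena-4658), route `SynchronousCoupling`

Lead skeleton (prover-line-stmt-CriticalPhenomena-4658-0, 2026-08-17), built from the idea card
`Cruxes/UniformRegularity/Ideas/magnetic-ruler.md` (crux-ideate r1, ideator 1; its `Sketch.lean` is evidence-only).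

## The line

Deform the critical nearest-neighbour Ising model on `ℤ³` by a uniform field `h > 0` at `β = β_c` and lay the order
parameter `M(h) := ⟨σ₀⟩⁺_{β_c,h}` (`magnetizationInField 3 (criticalBeta 3) h`) against the zero-field critical
two-point function `g(x) := ⟨σ₀σ_x⟩⁺_{β_c,0}` (`criticalTwoPoint 3 x`). Write
`S_h(x) := ⟨σ₀σ_x⟩⁺_{β_c,h}` (`plusCorr 3 (criticalBeta 3) h {0, x}`).

* `stub_fieldMonotone` (LANDED p158710 — GKS II in the field, `plusCorr_mono_params`): `g(x) ≤ S_h(x)` (`h ≥ 0`, `x ≠ 0`).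
* `stub_ghsSandwich` (LANDED p158984 — GHS/Lebowitz: the truncated plus two-point function is nonincreasing in
  `h ≥ 0`, in finite volume with `+` b.c. then `L → ∞`, anchored at `m*(β_c) = 0`): `S_h(x) ≤ g(x) + M(h)²`.
* `stub_magnetizationRegular` (LANDED p158840): `h ↦ M(h)` is continuous on `(0,∞)` (right-continuity of the plus
  state, left-continuity of the free state, `free = plus` on `σ₀` for `h > 0`), `M(h) → m*(β_c) = 0` as `h ↓ 0`
  (landed `magnetizationInField_criticalBeta_tendsto_zero`), and `M(h) > 0` for `h > 0`.
* `stub_truncatedSumRule` (LANDED p159073 — GHS concavity of `s ↦ ⟨σ₀⟩⁺_{Λ_L;β_c,s}` on `[0,h]` anchored at a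
  nonnegative value, `∂_s⟨σ₀⟩ = β Σ_x ⟨σ₀;σ_x⟩`, truncated correlations `≥ 0`, then `L → ∞`): for every finite
  `Λ ∌ 0`, `β_c · h · Σ_{x∈Λ} (S_h(x) − M(h)²) ≤ M(h)` (the anchored Buckingham–Gunton sum rule).
* `stub_excessPropagation` (OPEN — the transferred crux `ECP`, held by the lead): one-octave EXCESS-CORRELATION
  PROPAGATION inside the magnetic window: `∃ K ≥ 2, κ > 0, h₀ > 0` such that for `0 < h < h₀`, `n ≥ 1` with
  `β_c · n · h · M(h) ≤ 1`: `S_h(n e₀) ≥ K·M(h)² ⟹ S_h(2n e₀) ≥ (1+κ)·M(h)²`.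

## Composition (kernel-checked below, no sorry outside the stubs)

`twoPointDoubling_of`: item 6150 `TwoPointDoubling` from the open stub 5 (stubs 1–4 landed and used by name) — for `n` with `g(n e₀)` below the threshold
`K·M(h₀/2)²` pick `h⋆ ∈ (0, h₀/2]` with `K·M(h⋆)² = g(n e₀)` (IVT: stub 3), check the window by the sum rule on
`Λ = {e₀, …, n e₀}` (stubs 4 + 1 + axis monotonicity: each term `≥ g(n e₀) − M² = (K−1)M² ≥ M²`), feed ECP
(hypothesis by stub 1), read `g(2n e₀) ≥ S_{h⋆}(2n e₀) − M² ≥ κM² = (κ/K)·g(n e₀)` (stub 2); the finitely many `n`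
above the threshold (`g → 0` along the axis, landed) by positivity and axis monotonicity. Then
`UniformRegularity_of` = landed item map 6150 ⟹ 4658 (`ItemMaps.uniformRegularity_of_doubling`, p120504) read in the
`SynchronousCoupling` namespace (`Iff.rfl` with the `MonotoneRG` copy).

`excessPropagation_of_doubling` (proved): 6150 ⟹ ECP (via the landed stubs 1–2), so the open stub is EXACTLY crux-strength;
`uniformRegularity_iff_excessPropagation`: the crux ⟺ stub 5.

Disproof used: none on file at build time (`ledger crux ls`: no `Disproof.lean`; payload `disproof_path` not on disk).
Honoured: `Theorems/UniformRegularity/Negative/LoadBearing` (entered only through the landed 6150 ⟹ 4658 map),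
`ZoomMonotone/Negative/{DoublingWitness, AxisStructureInsufficient}` (ECP quantifies over the `h`-family, not over
axis facts of `g`).

References: Fernández–Fröhlich–Sokal 1992 §12.4, §14.3.5 [FFS1992]; Lebowitz 1974 (GHS) [Lebowitz1974];
Aizenman–Barsky–Fernández 1987 [AizenmanBarskyFernandez1987]; Friedli–Velenik 2017 §3.6–3.7 [FriedliVelenik2017];
Aizenman–Duminil-Copin 2021 §5 [AizenmanDuminilCopinAnnals2021].
-/

noncomputable section

namespace Summit.CriticalPhenomena.Ising3DConformalLimit.Cruxes.UniformRegularity.MagneticRuler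

open scoped BigOperators Topology
open Filter Set
open Literature.Probability.LatticeModels

/-! ## The registered stubs (signatures fully qualified over importable vocabulary) -/

/-- **STUB 1 · `stub_fieldMonotone` (LANDED p158710, `Theorems.MagneticRuler.stub_fieldMonotone`).** GKS II in the field for the plus state at `β_c`:
`⟨σ₀σ_x⟩⁺_{β_c,0} ≤ ⟨σ₀σ_x⟩⁺_{β_c,h}` for `h ≥ 0`, `x ≠ 0` (tree: `plusCorr_mono_params`, `twoPointPlus_eq_plusCorr`).
[FriedliVelenik2017 §3.6, Exercise 3.12 / Thm 3.17] -/
theorem stub_fieldMonotone :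
    ∀ h : ℝ, 0 ≤ h → ∀ x : Literature.Probability.LatticeModels.Site 3, x ≠ 0 →
      Literature.Probability.LatticeModels.criticalTwoPoint 3 x ≤
        Literature.Probability.LatticeModels.plusCorr 3 (Literature.Probability.LatticeModels.criticalBeta 3) h
          {0, x} := by
  exact Summit.CriticalPhenomena.Ising3DConformalLimit.Theorems.MagneticRuler.stub_fieldMonotone

/-- **STUB 2 · `stub_ghsSandwich` (LANDED p158984, `Theorems.MagneticRuler.stub_ghsSandwich`).** The GHS/Lebowitz upper sandwich at `β_c`:
`⟨σ₀σ_x⟩⁺_{β_c,h} ≤ ⟨σ₀σ_x⟩⁺_{β_c,0} + (⟨σ₀⟩⁺_{β_c,h})²` for `h ≥ 0`, `x ≠ 0` — the truncated plus two-point function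
`⟨σ₀;σ_x⟩⁺_{β_c,h}` is nonincreasing in `h ≥ 0` (GHS) and equals `g(x) − m*(β_c)² = g(x)` at `h = 0`.
[Lebowitz1974; FFS1992 §12.4 (12.129); FriedliVelenik2017 §3.7] -/
theorem stub_ghsSandwich :
    ∀ h : ℝ, 0 ≤ h → ∀ x : Literature.Probability.LatticeModels.Site 3, x ≠ 0 →
      Literature.Probability.LatticeModels.plusCorr 3 (Literature.Probability.LatticeModels.criticalBeta 3) h {0, x} ≤
        Literature.Probability.LatticeModels.criticalTwoPoint 3 x +
          (Literature.Probability.LatticeModels.magnetizationInField 3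
            (Literature.Probability.LatticeModels.criticalBeta 3) h) ^ 2 := by
  exact Summit.CriticalPhenomena.Ising3DConformalLimit.Theorems.MagneticRuler.stub_ghsSandwich

/-- **STUB 3 · `stub_magnetizationRegular` (LANDED p158840, `Theorems.MagneticRuler.stub_magnetizationRegular`).** Regularity of the critical isotherm
`h ↦ M(h) = ⟨σ₀⟩⁺_{β_c,h}` on `ℤ³`: continuous on `(0,∞)`, tends to `m*(β_c) = 0` as `h ↓ 0`, positive for `h > 0`.
[FriedliVelenik2017 Lemma 3.31, Thm 3.25; AizenmanDuminilCopinSidoravicius2015 (m*(β_c)=0)] -/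
theorem stub_magnetizationRegular :
    ContinuousOn (fun h : ℝ => Literature.Probability.LatticeModels.magnetizationInField 3
        (Literature.Probability.LatticeModels.criticalBeta 3) h) (Set.Ioi 0) ∧
      Filter.Tendsto (fun h : ℝ => Literature.Probability.LatticeModels.magnetizationInField 3
        (Literature.Probability.LatticeModels.criticalBeta 3) h) (nhdsWithin 0 (Set.Ioi 0)) (nhds 0) ∧
      ∀ h : ℝ, 0 < h → 0 < Literature.Probability.LatticeModels.magnetizationInField 3
        (Literature.Probability.LatticeModels.criticalBeta 3) h := by
  exact Summit.CriticalPhenomena.Ising3DConformalLimit.Theorems.MagneticRuler.stub_magnetizationRegular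

/-- **STUB 4 · `stub_truncatedSumRule` (LANDED p159073, `Theorems.MagneticRuler.stub_truncatedSumRule`).** The anchored GHS sum rule (pointwise Buckingham–Gunton
calibration): for `h > 0` and every finite `Λ ∌ 0`,
`β_c · h · Σ_{x∈Λ} (⟨σ₀σ_x⟩⁺_{β_c,h} − M(h)²) ≤ M(h)` (GHS concavity of `s ↦ ⟨σ₀⟩⁺_{Λ_L;β_c,s}` on `[0,h]`,
`∂_s⟨σ₀⟩ = β Σ_y ⟨σ₀;σ_y⟩ ≥ β Σ_{y∈Λ} ⟨σ₀;σ_y⟩`, then `L → ∞`). [FFS1992 §14.3.5 (14.252); Lebowitz1974] -/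
theorem stub_truncatedSumRule :
    ∀ h : ℝ, 0 < h → ∀ Λ : Finset (Literature.Probability.LatticeModels.Site 3),
      (0 : Literature.Probability.LatticeModels.Site 3) ∉ Λ →
      Literature.Probability.LatticeModels.criticalBeta 3 * h *
          ∑ x ∈ Λ, (Literature.Probability.LatticeModels.plusCorr 3
              (Literature.Probability.LatticeModels.criticalBeta 3) h {0, x} -
            (Literature.Probability.LatticeModels.magnetizationInField 3
              (Literature.Probability.LatticeModels.criticalBeta 3) h) ^ 2) ≤
        Literature.Probability.LatticeModels.magnetizationInField 3
          (Literature.Probability.LatticeModels.criticalBeta 3) h := by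
  exact Summit.CriticalPhenomena.Ising3DConformalLimit.Theorems.MagneticRuler.stub_truncatedSumRule

/-- **STUB 5 · `stub_excessPropagation` (OPEN — the transferred crux ECP, window-localised).** There are `K ≥ 2`,
`κ > 0`, `h₀ > 0` such that for every field `0 < h < h₀` and every `n ≥ 1` inside the magnetic window
`β_c · n · h · M(h) ≤ 1`: if the pair correlation at distance `n` exceeds `K·M(h)²` then at distance `2n` it still
exceeds `(1+κ)·M(h)²`. Equivalent to item 6150 given stubs 1–2 (`excessPropagation_of_doubling` below and
`twoPointDoubling_of`). [FFS1992 §12.4; AizenmanDuminilCopinAnnals2021 §5.6, Rem 5.10] -/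
theorem stub_excessPropagation :
    ∃ K κ h₀ : ℝ, 2 ≤ K ∧ 0 < κ ∧ 0 < h₀ ∧ ∀ h ∈ Set.Ioo (0 : ℝ) h₀, ∀ n : ℕ, 1 ≤ n →
      Literature.Probability.LatticeModels.criticalBeta 3 *
          ((n : ℝ) * h * Literature.Probability.LatticeModels.magnetizationInField 3
            (Literature.Probability.LatticeModels.criticalBeta 3) h) ≤ 1 →
      K * (Literature.Probability.LatticeModels.magnetizationInField 3
            (Literature.Probability.LatticeModels.criticalBeta 3) h) ^ 2 ≤
        Literature.Probability.LatticeModels.plusCorr 3 (Literature.Probability.LatticeModels.criticalBeta 3) h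
          {0, Pi.single 0 (n : ℤ)} →
      (1 + κ) * (Literature.Probability.LatticeModels.magnetizationInField 3
            (Literature.Probability.LatticeModels.criticalBeta 3) h) ^ 2 ≤
        Literature.Probability.LatticeModels.plusCorr 3 (Literature.Probability.LatticeModels.criticalBeta 3) h
          {0, Pi.single 0 (2 * (n : ℤ))} := by
  sorry

/-! ## Names for the statements (hypotheses of the composition) -/

namespace Statement

/-- Statement of `stub_fieldMonotone`. -/
abbrev stub_fieldMonotone : Prop := type_of% MagneticRuler.stub_fieldMonotone
/-- Statement of `stub_ghsSandwich`. -/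
abbrev stub_ghsSandwich : Prop := type_of% MagneticRuler.stub_ghsSandwich
/-- Statement of `stub_magnetizationRegular`. -/
abbrev stub_magnetizationRegular : Prop := type_of% MagneticRuler.stub_magnetizationRegular
/-- Statement of `stub_truncatedSumRule`. -/
abbrev stub_truncatedSumRule : Prop := type_of% MagneticRuler.stub_truncatedSumRule
/-- Statement of `stub_excessPropagation`. -/
abbrev stub_excessPropagation : Prop := type_of% MagneticRuler.stub_excessPropagation

end Statement

/-! ## Landed inputs and small lemmas used by the composition (proved, no sorry) -/

/-- The crux decl of route `SynchronousCoupling` is VERBATIM the `UniformRegularity` decl of route `MonotoneRG`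
(shared item stmt-CriticalPhenomena-4658). [folklore] -/
theorem monotoneRG_uniformRegularity_iff_synchronousCoupling :
    Summit.CriticalPhenomena.Ising3DConformalLimit.Theses.MonotoneRG.UniformRegularity ↔
      Summit.CriticalPhenomena.Ising3DConformalLimit.Theses.SynchronousCoupling.UniformRegularity :=
  Iff.rfl

/-- The axis point `n e₀` of `ℤ³` is nonzero for `n ≠ 0`. [folklore] -/
theorem single_axis_ne_zero {n : ℤ} (hn : n ≠ 0) : (Pi.single 0 n : Site 3) ≠ 0 := by
  intro h
  have := congrFun h 0
  simp only [Pi.single_eq_same, Pi.zero_apply] at this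
  exact hn this

/-- The critical axis two-point function `n ↦ g(n e₀)` tends to `0` (landed squeeze `c‖x‖⁻² ≤ g ≤ C‖x‖⁻¹`). [folklore] -/
theorem axis_tendsto_zero :
    Tendsto (fun n : ℕ => criticalTwoPoint 3 (Pi.single 0 (n : ℤ))) atTop (𝓝 0) :=
  criticalTwoPoint_tendsto_zero_cofinite.comp tendsto_natCast_single_axis_cofinite

/-- **The magnetic window from the sum rule.** If `h > 0`, `M(h) > 0`, `n ≥ 1` and every axis pair correlation
`S_h(k e₀) − M(h)²`, `1 ≤ k ≤ n`, is at least `M(h)²`, then the anchored sum rule on `Λ = {e₀,…,n e₀}` gives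
`β_c · n · h · M(h) ≤ 1`. [FFS1992 §14.3.5] -/
theorem window_of_sumRule (h₄ : Statement.stub_truncatedSumRule) {h : ℝ} (hh : 0 < h)
    (hM : 0 < magnetizationInField 3 (criticalBeta 3) h) {n : ℕ}
    (hterm : ∀ k : ℕ, 1 ≤ k → k ≤ n →
      (magnetizationInField 3 (criticalBeta 3) h) ^ 2 ≤
        plusCorr 3 (criticalBeta 3) h {0, Pi.single 0 (k : ℤ)} - (magnetizationInField 3 (criticalBeta 3) h) ^ 2) :
    criticalBeta 3 * ((n : ℝ) * h * magnetizationInField 3 (criticalBeta 3) h) ≤ 1 := by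
  set M := magnetizationInField 3 (criticalBeta 3) h with hMdef
  set f : ℕ → Site 3 := fun k => Pi.single 0 (k : ℤ) with hf
  have hfinj : Function.Injective f := by
    intro a b hab
    have := congrFun hab 0
    simpa [hf] using this
  set Λ : Finset (Site 3) := (Finset.Icc 1 n).image f with hΛ
  have h0 : (0 : Site 3) ∉ Λ := by
    intro hmem
    obtain ⟨k, hk, hk0⟩ := Finset.mem_image.1 hmem
    have hk1 : 1 ≤ k := (Finset.mem_Icc.1 hk).1
    have : (Pi.single 0 (k : ℤ) : Site 3) ≠ 0 := single_axis_ne_zero (by exact_mod_cast (by omega : k ≠ 0))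
    exact this hk0
  have hsum := h₄ h hh Λ h0
  have hβ : 0 ≤ criticalBeta 3 := criticalBeta_nonneg 3
  -- the sum over Λ is at least n · M²
  have hlow : (n : ℝ) * M ^ 2 ≤ ∑ x ∈ Λ, (plusCorr 3 (criticalBeta 3) h {0, x} - M ^ 2) := by
    rw [hΛ, Finset.sum_image fun a _ b _ hab => hfinj hab]
    have : ∑ _k ∈ Finset.Icc 1 n, M ^ 2 = (n : ℝ) * M ^ 2 := by
      rw [Finset.sum_const, Nat.card_Icc, nsmul_eq_mul]
      push_cast
      ring_nf
    rw [← this]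
    exact Finset.sum_le_sum fun k hk => hterm k (Finset.mem_Icc.1 hk).1 (Finset.mem_Icc.1 hk).2
  have h1 : criticalBeta 3 * h * ((n : ℝ) * M ^ 2) ≤ M :=
    le_trans (mul_le_mul_of_nonneg_left hlow (mul_nonneg hβ hh.le)) hsum
  -- divide by M > 0
  have h2 : criticalBeta 3 * ((n : ℝ) * h * M) * M ≤ 1 * M := by nlinarith [h1]
  exact le_of_mul_le_mul_right h2 hM

/-! ## The composition (kernel-checked): the five stubs give item 6150, hence the crux BY NAME -/

/-- **Item 6150 `TwoPointDoubling` from the open stub** (the transfer of the magnetic ruler; stubs 1–4 are landed theorems). -/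
theorem twoPointDoubling_of (h₅ : Statement.stub_excessPropagation) :
    Summit.CriticalPhenomena.Ising3DConformalLimit.Theses.MirrorHoelderCompactness.TwoPointDoubling := by
  have h₁ : Statement.stub_fieldMonotone := stub_fieldMonotone
  have h₂ : Statement.stub_ghsSandwich := stub_ghsSandwich
  have h₄ : Statement.stub_truncatedSumRule := stub_truncatedSumRule
  obtain ⟨K, κ, h₀, hK, hκ, hh₀, hECP⟩ := h₅
  obtain ⟨hcont, hlim, hMpos⟩ := stub_magnetizationRegular
  set M : ℝ → ℝ := fun h => magnetizationInField 3 (criticalBeta 3) h with hMdef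
  set G : ℕ → ℝ := fun n => criticalTwoPoint 3 (Pi.single 0 (n : ℤ)) with hGdef
  have hGpos : ∀ n, 0 < G n := fun n => criticalTwoPoint_axis_pos n
  have hGanti : Antitone G := criticalTwoPoint_axis_antitone
  have hKpos : 0 < K := by linarith
  -- threshold field and threshold level
  set b : ℝ := h₀ / 2 with hbdef
  have hb : 0 < b := by positivity
  have hb₀ : b < h₀ := by rw [hbdef]; linarith
  have hMb : 0 < M b := hMpos b hb
  set γ : ℝ := K * M b ^ 2 with hγdef
  have hγ : 0 < γ := by positivity
  -- beyond N₀ the axis two-point function is below the threshold level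
  obtain ⟨N₀, hN₀⟩ : ∃ N₀ : ℕ, ∀ n ≥ N₀, G n ≤ γ := by
    have hev : ∀ᶠ n in atTop, G n ≤ γ := (axis_tendsto_zero.eventually (eventually_le_nhds hγ))
    exact eventually_atTop.1 hev
  have hcast : ∀ n : ℕ, ((2 * n : ℕ) : ℤ) = 2 * (n : ℤ) := fun n => by push_cast; ring
  refine ⟨min (G (2 * (N₀ + 1))) (κ / K), lt_min (hGpos _) (by positivity), fun n hn => ?_⟩
  rw [← hcast n]
  change min (G (2 * (N₀ + 1))) (κ / K) * G n ≤ G (2 * n)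
  by_cases hsmall : n ≤ N₀
  · -- finitely many scales: positivity and axis monotonicity
    have h2n : G (2 * (N₀ + 1)) ≤ G (2 * n) := hGanti (by omega)
    have hGn1 : G n ≤ 1 := criticalTwoPoint_le_one' _
    calc min (G (2 * (N₀ + 1))) (κ / K) * G n ≤ G (2 * (N₀ + 1)) * G n :=
          mul_le_mul_of_nonneg_right (min_le_left _ _) (hGpos n).le
      _ ≤ G (2 * (N₀ + 1)) * 1 := mul_le_mul_of_nonneg_left hGn1 (hGpos _).le
      _ ≤ G (2 * n) := by rw [mul_one]; exact h2n
  · -- the ruler: choose h⋆ with K · M(h⋆)² = G n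
    push Not at hsmall
    have hGnγ : G n ≤ γ := hN₀ n hsmall.le
    -- a small field a ∈ (0, h₁) with K · M(a)² ≤ G n
    obtain ⟨a, ha0, hab, haG⟩ : ∃ a : ℝ, 0 < a ∧ a < b ∧ K * M a ^ 2 ≤ G n := by
      have hφ : Tendsto (fun h => K * M h ^ 2) (𝓝[>] (0 : ℝ)) (𝓝 (K * 0 ^ 2)) :=
        (hlim.pow 2).const_mul K
      rw [zero_pow two_ne_zero, mul_zero] at hφ
      have hev₁ : ∀ᶠ h in 𝓝[>] (0 : ℝ), K * M h ^ 2 ≤ G n := hφ.eventually (eventually_le_nhds (hGpos n))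
      have hev₂ : ∀ᶠ h in 𝓝[>] (0 : ℝ), h ∈ Ioo 0 b := Ioo_mem_nhdsGT hb
      obtain ⟨a, ha, ha'⟩ := (hev₁.and hev₂).exists
      exact ⟨a, ha'.1, ha'.2, ha⟩
    -- IVT on [a, b]
    have hφcont : ContinuousOn (fun h => K * M h ^ 2) (Icc a b) :=
      continuousOn_const.mul ((hcont.mono fun x hx => lt_of_lt_of_le ha0 hx.1).pow 2)
    obtain ⟨hs, ⟨has, hsb⟩, hseq⟩ : ∃ hs ∈ Icc a b, K * M hs ^ 2 = G n :=
      intermediate_value_Icc hab.le hφcont ⟨haG, hGnγ⟩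
    have hs0 : 0 < hs := lt_of_lt_of_le ha0 has
    have hsIoo : hs ∈ Ioo 0 h₀ := ⟨hs0, lt_of_le_of_lt hsb hb₀⟩
    have hMs : 0 < M hs := hMpos hs hs0
    -- the window, by the sum rule on Λ = {e₀, …, n e₀}
    have hwin : criticalBeta 3 * ((n : ℝ) * hs * M hs) ≤ 1 := by
      refine window_of_sumRule h₄ hs0 hMs fun k hk1 hkn => ?_
      have hk0 : (Pi.single 0 (k : ℤ) : Site 3) ≠ 0 := single_axis_ne_zero (by exact_mod_cast (by omega : k ≠ 0))
      have hlowk : G n ≤ plusCorr 3 (criticalBeta 3) hs {0, Pi.single 0 (k : ℤ)} :=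
        le_trans (hGanti hkn) (h₁ hs hs0.le _ hk0)
      -- G n = K M² ≥ 2 M²
      have : 2 * M hs ^ 2 ≤ G n := by rw [← hseq]; exact mul_le_mul_of_nonneg_right hK (sq_nonneg _)
      change M hs ^ 2 ≤ plusCorr 3 (criticalBeta 3) hs {0, Pi.single 0 (k : ℤ)} - M hs ^ 2
      linarith
    -- feed ECP
    have hn0 : (Pi.single 0 (n : ℤ) : Site 3) ≠ 0 := single_axis_ne_zero (by exact_mod_cast (by omega : n ≠ 0))
    have hhyp : K * M hs ^ 2 ≤ plusCorr 3 (criticalBeta 3) hs {0, Pi.single 0 (n : ℤ)} := by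
      rw [hseq]; exact h₁ hs hs0.le _ hn0
    have hconc := hECP hs hsIoo n hn hwin hhyp
    -- read the conclusion back at h = 0 through the upper sandwich at 2n
    have h2n0 : (Pi.single 0 (2 * (n : ℤ)) : Site 3) ≠ 0 :=
      single_axis_ne_zero (by exact_mod_cast (by omega : 2 * n ≠ 0))
    have hup := h₂ hs hs0.le _ h2n0
    rw [← hcast n] at hup hconc
    change plusCorr 3 (criticalBeta 3) hs {0, Pi.single 0 ((2 * n : ℕ) : ℤ)} ≤ G (2 * n) + M hs ^ 2 at hup
    have hkey : κ * M hs ^ 2 ≤ G (2 * n) := by linarith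
    calc min (G (2 * (N₀ + 1))) (κ / K) * G n ≤ κ / K * G n :=
          mul_le_mul_of_nonneg_right (min_le_right _ _) (hGpos n).le
      _ = κ * M hs ^ 2 := by rw [← hseq]; field_simp
      _ ≤ G (2 * n) := hkey

/-- **`UniformRegularity` (route `SynchronousCoupling`) from the stubs**: item 6150 by `twoPointDoubling_of`, then the
landed item map 6150 ⟹ 4658 (`ItemMaps.uniformRegularity_of_doubling`, `MonotoneRG` namespace, verbatim the
`SynchronousCoupling` decl). -/
theorem UniformRegularity_of (h₅ : Statement.stub_excessPropagation) :
    Summit.CriticalPhenomena.Ising3DConformalLimit.Theses.SynchronousCoupling.UniformRegularity :=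
  monotoneRG_uniformRegularity_iff_synchronousCoupling.1
    (Summit.CriticalPhenomena.Ising3DConformalLimit.Cruxes.ExistsScaleCovariantLimit.TwoHierarchies.ItemMaps.uniformRegularity_of_doubling
      (twoPointDoubling_of h₅))

/-! ## The open stub is exactly crux-strength -/

/-- **ECP from doubling** (proved): item 6150 and the two sandwich stubs give `stub_excessPropagation` with
`K = 2 + 2/κ₀`, `κ = 1`, `h₀ = 1` (the window hypothesis is not even used). So the open stub is implied by the crux
(4658 ⟺ 6150, landed) and no strength is smuggled in. [folklore] -/
theorem excessPropagation_of_doubling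
    (hD : Summit.CriticalPhenomena.Ising3DConformalLimit.Theses.MirrorHoelderCompactness.TwoPointDoubling) :
    Statement.stub_excessPropagation := by
  have h₁ : Statement.stub_fieldMonotone := stub_fieldMonotone
  have h₂ : Statement.stub_ghsSandwich := stub_ghsSandwich
  obtain ⟨κ₀, hκ₀, hd⟩ := hD
  refine ⟨2 + 2 / κ₀, 1, 1, by have := div_pos two_pos hκ₀; linarith, one_pos, one_pos, ?_⟩
  intro h hh n hn _ hhyp
  set M := magnetizationInField 3 (criticalBeta 3) h with hMdef
  have hn0 : (Pi.single 0 (n : ℤ) : Site 3) ≠ 0 := single_axis_ne_zero (by exact_mod_cast (by omega : n ≠ 0))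
  have h2n0 : (Pi.single 0 (2 * (n : ℤ)) : Site 3) ≠ 0 :=
    single_axis_ne_zero (by exact_mod_cast (by omega : 2 * n ≠ 0))
  have hup := h₂ h hh.1.le _ hn0
  -- g(n) ≥ (K - 1) M² = (1 + 2/κ₀) M²
  have hg : (1 + 2 / κ₀) * M ^ 2 ≤ criticalTwoPoint 3 (Pi.single 0 (n : ℤ)) := by linarith
  have hdn := hd n hn
  have hlow := h₁ h hh.1.le _ h2n0
  -- κ₀ g(n) ≥ (κ₀ + 2) M² ≥ 2 M²
  have hM2 : 0 ≤ M ^ 2 := sq_nonneg _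
  have : (κ₀ + 2) * M ^ 2 ≤ κ₀ * criticalTwoPoint 3 (Pi.single 0 (n : ℤ)) := by
    have := mul_le_mul_of_nonneg_left hg hκ₀.le
    calc (κ₀ + 2) * M ^ 2 = κ₀ * ((1 + 2 / κ₀) * M ^ 2) := by field_simp
      _ ≤ κ₀ * criticalTwoPoint 3 (Pi.single 0 (n : ℤ)) := this
  nlinarith

/-- **The crux is exactly the open stub**: `UniformRegularity ⟺ ECP` (through the landed `uniformRegularity_iff_doubling`,
p120504, and the two transfers above). [folklore] -/
theorem uniformRegularity_iff_excessPropagation :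
    Summit.CriticalPhenomena.Ising3DConformalLimit.Theses.SynchronousCoupling.UniformRegularity ↔
      Statement.stub_excessPropagation :=
  ⟨fun h => excessPropagation_of_doubling
      ((Summit.CriticalPhenomena.Ising3DConformalLimit.Cruxes.ExistsScaleCovariantLimit.TwoHierarchies.ItemMaps.uniformRegularity_iff_doubling).1
        (monotoneRG_uniformRegularity_iff_synchronousCoupling.2 h)),
    UniformRegularity_of⟩

end Summit.CriticalPhenomena.Ising3DConformalLimit.Cruxes.UniformRegularity.MagneticRuler

end
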